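import Summits.RiemannHypothesis.RiemannHypothesis.Theorems.PfPersistenceM2EvenSectorCosineFactor
import HarnessLib

/-!
# Persistence programme, M2 even sector — sharpness of the summability criterion
(pub-rhpf cell, M2 seat, gen 7, remark to parts 7a–7d)

Long-odds MECHANISM SEARCH; **no RH claims**.  RH-free, kernel-checked, [folklore] calculus.

Parts 7a–7d prove `(SUM) ∑ 1/Im ρₖ < ∞ ⇒ (MULT)` (one even real compactly supported test whose
Mellin–Weil transform kills every `ρₖ` and not `1/2`).  This remark records that the converse
FAILS, so that nobody reads an equivalence into the trichotomies
`encard_le_or_exists_not_summable` / `encard_le_or_exists_not_counting` of part 7d: their third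
branch (`∑_{𝒵_θ} 1/Im ρ = ∞`) is an artefact of the method, not an obstruction to `(MULT_θ)`.

* `threePointMul_eq_zero_odd` (PROVED): ONE cosine factor `T_ρ` of part 7a (half-period
  `a(ρ) = π/(2 Im ρ)`, weight `q(ρ) = e^{-2a(ρ)(Re ρ - 1/2)}`) already kills the whole ODD
  PROGRESSION `Re ρ + i(2k+1) Im ρ`, `k ∈ ℤ` — because `e^{2a(ρ)((2k+1) Im ρ) i} = e^{(2k+1)πi} = -1`.
* `exists_evenRealTest_vanish_oddProgression` (PROVED): hence the single test
  `φ = T_ρ(cosSeed)` (even, real, smooth, support in `[-(1+2a(ρ)), 1+2a(ρ)]`, `φ^(1/2) ≠ 0`)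
  annihilates `Z_ρ = {Re ρ + i(2k+1) Im ρ : k ≥ 0}`;
* `not_summable_inv_im_oddProgression` (PROVED): while `∑_{k ≥ 0} 1/((2k+1) Im ρ) = ∞`;
* `exists_annihilated_not_summable` (PROVED): packaged — for every `ρ` with `Im ρ > 0` there is
  an infinite set `Z ∋ ρ` on the vertical line through `ρ` in the upper half-plane with
  `∑_Z 1/Im = ∞` which IS annihilated by one even real compactly supported test non-vanishing at
  `1/2`.  So `(SUM)` is sufficient (part 7b) but not necessary for `(MULT)`.

(The sharp criterion for real frequency sets is the Beurling–Malliavin completeness-radius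
theorem; it is not needed anywhere in the programme and is not formalised.)
-/

noncomputable section
set_option linter.dupNamespace false

open Complex Filter Set MeasureTheory
open scoped Real Topology

namespace Summit.RiemannHypothesis.RiemannHypothesis.Theorems.PfPersistenceM2NegIndex.CosineProduct

open Literature.NumberTheory.LFunctions

/-- The `k`-th point `Re ρ + i (2k+1) Im ρ` of the odd progression through `ρ` (`k = 0` is `ρ`). -/
def oddProgression (ρ : ℂ) (k : ℤ) : ℂ := (ρ.re : ℂ) + (((2 * k + 1) * ρ.im : ℝ) : ℂ) * I

/-- `oddProgression ρ 0 = ρ`. -/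
@[simp] theorem oddProgression_zero (ρ : ℂ) : oddProgression ρ 0 = ρ := by
  apply Complex.ext <;> simp [oddProgression]

/-- Imaginary part of the `k`-th point: `(2k+1) Im ρ`. -/
@[simp] theorem oddProgression_im (ρ : ℂ) (k : ℤ) :
    (oddProgression ρ k).im = (2 * k + 1) * ρ.im := by
  simp [oddProgression]

/-- Real part of the `k`-th point: `Re ρ`. -/
@[simp] theorem oddProgression_re (ρ : ℂ) (k : ℤ) : (oddProgression ρ k).re = ρ.re := by
  simp [oddProgression]

/-- **One cosine factor kills the whole odd progression (PROVED):**
`threePointMul a(ρ) q(ρ) (Re ρ + i(2k+1) Im ρ) = 0` for every `k ∈ ℤ`, since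
`e^{± 2a(ρ)(s - 1/2)} = -q(ρ)^{∓1}` there and the numerator is `-q² + 1 + q² - 1 = 0`. [folklore] -/
theorem threePointMul_eq_zero_odd {ρ : ℂ} (hρ : 0 < ρ.im) (k : ℤ) :
    threePointMul (halfPeriod ρ) (cosWeight ρ) (oddProgression ρ k) = 0 := by
  unfold threePointMul cosWeight oddProgression
  set a := halfPeriod ρ with ha
  have h2a : ρ.im * (2 * a) = π := by
    have h2 : (2 * ρ.im) ≠ 0 := by positivity
    calc ρ.im * (2 * a) = 2 * ρ.im * π / (2 * ρ.im) := by rw [ha, halfPeriod]; ring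
      _ = π := mul_div_cancel_left₀ π h2
  have hexp : ((ρ.re : ℂ) + (((2 * k + 1) * ρ.im : ℝ) : ℂ) * I - 1 / 2) * ((2 * a : ℝ) : ℂ)
      = ((((ρ.re - 1 / 2) * (2 * a) : ℝ) : ℂ) + (k : ℂ) * (2 * π * I)) + π * I := by
    have h1 : (((2 * k + 1) * ρ.im : ℝ) : ℂ) * ((2 * a : ℝ) : ℂ) = (2 * k + 1) * π := by
      rw [← h2a]; push_cast; ring
    calc ((ρ.re : ℂ) + (((2 * k + 1) * ρ.im : ℝ) : ℂ) * I - 1 / 2) * ((2 * a : ℝ) : ℂ)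
        = (((ρ.re - 1 / 2) * (2 * a) : ℝ) : ℂ)
            + (((2 * k + 1) * ρ.im : ℝ) : ℂ) * ((2 * a : ℝ) : ℂ) * I := by push_cast; ring
      _ = _ := by rw [h1]; ring
  rw [div_eq_zero_iff]
  left
  rw [Complex.exp_neg, hexp, Complex.exp_add_pi_mul_I, Complex.exp_add,
    Complex.exp_int_mul_two_pi_mul_I, mul_one, Real.exp_neg, Complex.ofReal_inv,
    Complex.ofReal_exp]
  have hE : cexp ((((ρ.re - 1 / 2) * (2 * a) : ℝ) : ℂ)) ≠ 0 := Complex.exp_ne_zero _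
  field_simp
  ring

/-- **A non-summable configuration annihilated by ONE cosine factor (PROVED, RH-free):** for
`Im ρ > 0` the test `φ = T_ρ(cosSeed)` is even, real, smooth, supported in `[-b, b]`
(`b = 1 + 2a(ρ)`), has `φ^(1/2) ≠ 0`, and `φ^` vanishes at every point `Re ρ + i(2k+1) Im ρ`,
`k ∈ ℤ`, of the odd progression through `ρ`. [folklore] -/
theorem exists_evenRealTest_vanish_oddProgression {ρ : ℂ} (hρ : 0 < ρ.im) :
    ∃ φ : ℝ → ℂ, ∃ b : ℝ, IsWeilTest φ ∧ (∀ t : ℝ, φ (-t) = φ t) ∧ (∀ t : ℝ, (φ t).im = 0) ∧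
      tsupport φ ⊆ Icc (-b) b ∧ weilMellin φ (1 / 2) ≠ 0 ∧
      ∀ k : ℤ, weilMellin φ (oddProgression ρ k) = 0 := by
  have him : ∀ k : ℕ, 0 < ((fun _ : ℕ ↦ ρ) k).im := fun _ ↦ hρ
  refine ⟨phiSeq (fun _ ↦ ρ) 1, suppRadius (fun _ ↦ ρ) 1,
    isWeilTest_phiSeq (ρ := fun _ ↦ ρ) him 1, phiSeq_even (ρ := fun _ ↦ ρ) 1,
    phiSeq_im (ρ := fun _ ↦ ρ) 1, ?_, ?_, fun k ↦ ?_⟩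
  · refine closure_minimal (fun t ht ↦ ?_) isClosed_Icc
    by_contra h
    exact ht (phiSeq_eq_zero (ρ := fun _ ↦ ρ) him 1 t
      (lt_of_not_ge fun hle ↦ h (mem_Icc.2 (abs_le.1 hle))))
  · rw [weilMellin_phiSeq_half (ρ := fun _ ↦ ρ) him]
    exact weilMellin_cosSeed_half_ne_zero
  · rw [weilMellin_phiSeq (ρ := fun _ ↦ ρ) him, mulProd, Finset.prod_range_one,
      threePointMul_eq_zero_odd hρ k, zero_mul]

/-- **… although `∑_{k ≥ 0} 1/Im = ∞` along the progression (PROVED):** the reciprocals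
`1/((2k+1) Im ρ)` are not summable over `k ∈ ℕ` (comparison with the harmonic series). -/
theorem not_summable_inv_im_oddProgression {ρ : ℂ} (hρ : 0 < ρ.im) :
    ¬ Summable fun k : ℕ ↦ 1 / (oddProgression ρ k).im := by
  intro hS
  have h1 : Summable fun k : ℕ ↦ 1 / ((k : ℝ) + 1) := by
    refine (hS.mul_left (3 * ρ.im)).of_nonneg_of_le (fun k ↦ by positivity) fun k ↦ ?_
    rw [oddProgression_im]
    push_cast
    have hk : (0 : ℝ) ≤ k := k.cast_nonneg
    rw [mul_one_div, div_le_div_iff₀ (by positivity) (by positivity)]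
    nlinarith [hρ, hk]
  have h2 : Summable fun n : ℕ ↦ 1 / (n : ℝ) :=
    (summable_nat_add_iff 1).1 (by simpa [Nat.cast_add, Nat.cast_one] using h1)
  exact Real.not_summable_one_div_natCast h2

/-- **`(SUM)` is sufficient but NOT necessary for `(MULT)` (PROVED, RH-free):** for every `ρ`
with `Im ρ > 0` there is an infinite set `Z ∋ ρ` of points `z` with `Re z = Re ρ`, `Im z > 0` and
`∑_{z ∈ Z} 1/Im z = ∞`, which is nevertheless annihilated by one even real compactly supported
Weil test with non-zero transform at `1/2`. [folklore] -/
theorem exists_annihilated_not_summable {ρ : ℂ} (hρ : 0 < ρ.im) :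
    ∃ Z : Set ℂ, ρ ∈ Z ∧ Z.Infinite ∧ (∀ z ∈ Z, z.re = ρ.re ∧ 0 < z.im) ∧
      ¬ Summable (fun z : ↥Z ↦ 1 / (z : ℂ).im) ∧
      ∃ φ : ℝ → ℂ, ∃ b : ℝ, IsWeilTest φ ∧ (∀ t : ℝ, φ (-t) = φ t) ∧ (∀ t : ℝ, (φ t).im = 0) ∧
        tsupport φ ⊆ Icc (-b) b ∧ weilMellin φ (1 / 2) ≠ 0 ∧ ∀ z ∈ Z, weilMellin φ z = 0 := by
  set f : ℕ → ℂ := fun k ↦ oddProgression ρ k with hf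
  have hinj : Function.Injective f := by
    intro k l hkl
    have h := congrArg Complex.im hkl
    simp only [hf, oddProgression_im, Int.cast_natCast] at h
    have : (k : ℝ) = l := by nlinarith [hρ]
    exact_mod_cast this
  obtain ⟨φ, b, hW, hev, hre, hsupp, hhalf, hvan⟩ := exists_evenRealTest_vanish_oddProgression hρ
  refine ⟨range f, ⟨0, by simp [hf]⟩, infinite_range_of_injective hinj, ?_, ?_,
    φ, b, hW, hev, hre, hsupp, hhalf, ?_⟩
  · rintro z ⟨k, rfl⟩
    refine ⟨by simp [hf], ?_⟩
    simp only [hf, oddProgression_im, Int.cast_natCast]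
    positivity
  · intro hS
    have h := (Equiv.summable_iff (Equiv.ofInjective f hinj)).2 hS
    refine not_summable_inv_im_oddProgression hρ (h.congr fun k ↦ ?_)
    simp [hf]
  · rintro z ⟨k, rfl⟩
    simpa [hf] using hvan k

end Summit.RiemannHypothesis.RiemannHypothesis.Theorems.PfPersistenceM2NegIndex.CosineProduct
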